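import Summits.ABC.IUTFork.Thm311RealInd1StripTwistJWPlanes
import Summits.ABC.IUTFork.Thm311RealInd1StripSignature
import HarnessLib

/-!
# [IUTchIII] Thm 3.11 (i) (Ind1) at `v ∈ 𝕍^non`: print's strip part is CLOSED UNDER COMPOSITION, and — modulo the group-level
# Jannsen–Wingberg fact — INFINITE at every `v ∣ p` odd with `[K_v : ℚ_p] ≥ 3` (Hoshi–Nishio 2022 Thm 1.5 / Cor 1.6 (i) at the real log-shell)

PROOF-ONLY file (abc-iut cell, Cor. 3.12 sub-crew, seat abc-iut-c312-1 = holder of record of the typed [IUTchIII] Thm. 3.11,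
gen 11; row «R13 TRACE-RIGIDITY», part d).  TAKES NO SIDE on [IUTchIII] Cor. 3.12.

* `Real.trans_mem_ind1StripOf`, `Real.add_mem_ind1StripOf`, `Real.nsmul_mem_ind1StripOf` — UNCONDITIONAL: print's (Ind1) strip part
  `Real.ind1StripOf v L` (the bicontinuous additive automorphisms of `K_v` realising, through `L` on `𝒪_v^×`, THE equivariant lift of a
  topological automorphism of `G_v`) is closed under composition (`liftUnits_trans`: the lift of `φ₁ ∘ φ₂` is the composite of the lifts),
  hence under iteration in `AddAut(K_v)` (written additively in Mathlib).
* **`Real.ind1StripOf_infinite_of_jannsenWingberg`** (+ carrier form `Real.ind1Strip_infinite_of_jannsenWingberg`) — assuming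
  `JannsenWingbergTwists`, at every finite place `v ∣ p` of a number field with `p` odd and `[K_v : ℚ_p] ≥ 3` the set
  `Real.ind1StripOf v (Real.galoisLog v)` is INFINITE: the realised Jannsen–Wingberg transvection `ψ` of a plane `(y_a, y_b)` is unipotent of
  infinite order, `ψ^n (y_b) = y_b + n·y_a` (Hoshi–Nishio Thm. 1.5: «`*α^n_+ ≠ id` and `( *α^n_+ − id)² = 0`»; Cor. 1.6 (i): «the image of
  `Out(G) → Aut(k_+(G))` is infinite»).  Contrast: Dupuy–Hilado's (Ind1) strip slot is `{1}` (c312-5 `Real.stripAutDH`).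
HONEST SCOPE: statements about OUR typed objects at ONE place; the second is conditional on `hJW`; nothing here asserts or refutes
[IUTchIII] Cor. 3.12.  [claim: Mochizuki2012, status: disputed]; [cite: HoshiNishio2022OuterAutMLF, Thm 1.5 and Cor 1.6 (i) p.5];
[cite: JannsenWingberg1982, §5.1 p.96]; [cite: Kondo2025OuterAutMLF, §2 proof of Thm 2.3 p.10].  typed ≠ proved; a conditional theorem
discharges nothing it binds.
-/

set_option autoImplicit false

noncomputable section

open Metric Set
open scoped Pointwise

namespace Summit.ABC.IUTFork.Thm311.Real

open NumberField IsDedekindDomain Literature.NumberTheory.NumberFields Literature.IUT.LogVolume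
open Literature.NumberTheory.GaloisRepresentations Literature.NumberTheory.GaloisRepresentations.Ultrametric
open Literature.AnabelianGeometry.AbsoluteAnabelian Literature.IUT.HodgeArakelov
open Literature.IUT.HodgeArakelov.AbsTopMonoids Literature.IUT.LogThetaLattice

variable {F : Type} [Field F] [NumberField F] (v : HeightOneSpectrum (𝓞 F))

/-! ## 1. The strip part is closed under composition (unconditional) -/

section Closure

variable (L : Additive (↥(v.adicCompletionIntegers F))ˣ →+ v.adicCompletion F)

/-- Realisations compose: if `ψ₁` realises the lift of `φ₁` and `ψ₂` that of `φ₂` through `L`, then `ψ₁ ≫ ψ₂` realises the lift of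
`φ₁ ≫ φ₂` (`liftUnits_trans`). [cite: MochizukiAbsTopIII2015, Proposition 3.2 (iv) p.72] -/
theorem realises_stripMulAut_trans {φ₁ φ₂ : Gal v ≃ₜ* Gal v} {ψ₁ ψ₂ : v.adicCompletion F ≃+ v.adicCompletion F}
    (h₁ : Realises v L (stripMulAut v φ₁) ψ₁) (h₂ : Realises v L (stripMulAut v φ₂) ψ₂) :
    Realises v L (stripMulAut v (φ₁.trans φ₂)) (ψ₁.trans ψ₂) := by
  rw [realises_stripMulAut_iff] at h₁ h₂ ⊢
  intro u
  rw [AddEquiv.trans_apply, h₁ u, h₂ (liftUnits v φ₁ u), liftUnits_trans]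

/-- **Print's (Ind1) strip part is closed under composition.** [claim: Mochizuki2012, status: disputed] -/
theorem trans_mem_ind1StripOf {ψ₁ ψ₂ : v.adicCompletion F ≃+ v.adicCompletion F} (h₁ : ψ₁ ∈ ind1StripOf v L)
    (h₂ : ψ₂ ∈ ind1StripOf v L) : ψ₁.trans ψ₂ ∈ ind1StripOf v L := by
  obtain ⟨hc₁, hs₁, φ₁, hr₁⟩ := h₁
  obtain ⟨hc₂, hs₂, φ₂, hr₂⟩ := h₂
  exact ⟨hc₂.comp hc₁, by exact hs₁.comp hs₂, φ₁.trans φ₂, realises_stripMulAut_trans v L hr₁ hr₂⟩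

/-- Closure under the composition law of the automorphism group `AddAut(K_v)` (written ADDITIVELY in Mathlib: `ψ₁ + ψ₂ = ψ₂ ≫ ψ₁`).
[claim: Mochizuki2012, status: disputed] -/
theorem add_mem_ind1StripOf {ψ₁ ψ₂ : AddAut (v.adicCompletion F)} (h₁ : ψ₁ ∈ ind1StripOf v L)
    (h₂ : ψ₂ ∈ ind1StripOf v L) : ψ₁ + ψ₂ ∈ ind1StripOf v L :=
  trans_mem_ind1StripOf v L h₂ h₁

/-- Closure under iteration (`n • ψ` = the `n`-fold composite in the additively written group `AddAut(K_v)`).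
[claim: Mochizuki2012, status: disputed] -/
theorem nsmul_mem_ind1StripOf {ψ : AddAut (v.adicCompletion F)} (h : ψ ∈ ind1StripOf v L) (n : ℕ) :
    n • ψ ∈ ind1StripOf v L := by
  induction n with
  | zero => rw [zero_nsmul]; exact refl_mem_ind1StripOf v L
  | succ n ih => rw [succ_nsmul]; exact add_mem_ind1StripOf v L ih h

end Closure

/-! ## 2. Infinitely many strip automorphisms (modulo Jannsen–Wingberg) -/

/-- **PRINT'S (Ind1) STRIP PART AT `v` IS INFINITE — at every `v ∣ p` odd with `[K_v : ℚ_p] ≥ 3`, modulo the group-level Jannsen–Wingberg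
fact.**  Assume `JannsenWingbergTwists`.  Then `Real.ind1StripOf v (Real.galoisLog v)` is an infinite set: the realised transvection `ψ` of
the first Jannsen–Wingberg plane (`exists_realised_planes_of_jannsenWingberg`: `ψ(x) = x + y_b^*(x)·y_a`, `y_b^*(y_a) = 0`, `y_b^*(y_b) = 1`) has
`ψ^n(y_b) = y_b + n·y_a` with `y_a ≠ 0`, so `n ↦ ψ^n` is injective into the strip part (Hoshi–Nishio Thm. 1.5 / Cor. 1.6 (i) at the real
log-shell carrier).  Contrast: Dupuy–Hilado's strip slot is `{1}`. [claim: Mochizuki2012, status: disputed]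
[cite: HoshiNishio2022OuterAutMLF, Thm 1.5 and Cor 1.6 (i) p.5] [cite: JannsenWingberg1982, §5.1 p.96] -/
theorem ind1StripOf_infinite_of_jannsenWingberg (hJW : JannsenWingbergTwists)
    (p : ℕ) [Fact p.Prime] (hv : ((p : ℕ) : 𝓞 F) ∈ v.asIdeal) (hp2 : p ≠ 2) (h3 : 3 ≤ localDeg F v) :
    (ind1StripOf v (galoisLog v)).Infinite := by
  obtain ⟨c, g, hc, hcard, ca, cb, ya, yb, ψ, ψ', haa, hbb, hab, hba, hψ, -, hT, -⟩ :=
    exists_realised_planes_of_jannsenWingberg v hJW p hv hp2 h3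
  have hg : 0 < g := by omega
  set i : Fin g := ⟨0, hg⟩
  set e := RescaledCompletion.of F p v hv with he
  -- `y_a ≠ 0`
  have hya : ya i ≠ 0 := by
    intro h0
    have h := haa i i
    rw [if_pos rfl, h0, map_zero] at h
    exact zero_ne_one h
  -- the realised transvection as an element of `AddAut(K_v)`
  set χ : AddAut (v.adicCompletion F) := ψ i with hχ
  have hχmem : χ ∈ ind1StripOf v (galoisLog v) := hψ i
  have hχT : ∀ x : RescaledCompletion F p v hv, e (χ (e.symm x)) = x + cb i x • ya i := hT i
  -- the iterates of `χ` act as `x ↦ x + n • (cb x • ya)`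
  have hpow : ∀ (n : ℕ) (x : RescaledCompletion F p v hv),
      e ((n • χ) (e.symm x)) = x + (n : ℚ_[p]) • (cb i x • ya i) := by
    intro n
    induction n with
    | zero => intro x; rw [zero_nsmul, Nat.cast_zero, zero_smul, add_zero]; exact e.apply_symm_apply x
    | succ n ih =>
      intro x
      rw [succ_nsmul, AddAut.add_apply, ← e.symm_apply_apply (χ (e.symm x)), hχT x, ih, map_add, map_smul, hba, smul_zero,
        add_zero, Nat.cast_succ, add_smul, one_smul, add_assoc, add_comm (cb i x • ya i)]
  -- `n ↦ n • χ` is injective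
  have hinj : Function.Injective fun n : ℕ => n • χ := by
    intro n m hnm
    have h := congrArg (fun ξ : AddAut (v.adicCompletion F) => e (ξ (e.symm (yb i)))) hnm
    simp only at h
    rw [hpow, hpow, hbb, if_pos rfl, one_smul, add_right_inj] at h
    exact_mod_cast smul_left_injective ℚ_[p] hya h
  exact Set.infinite_of_injective_forall_mem hinj fun n => nsmul_mem_ind1StripOf v (galoisLog v) hχmem n

/-- The same over abc-iut-c312-5's ANALYTIC logarithm. [claim: Mochizuki2012, status: disputed]
[cite: HoshiNishio2022OuterAutMLF, Cor 1.6 (i) p.5] -/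
theorem ind1StripOf_analyticLogv_infinite_of_jannsenWingberg (hJW : JannsenWingbergTwists)
    (p : ℕ) [Fact p.Prime] (hv : ((p : ℕ) : 𝓞 F) ∈ v.asIdeal) (hp2 : p ≠ 2) (h3 : 3 ≤ localDeg F v) :
    (ind1StripOf v (analyticLogv F v)).Infinite := by
  rw [← galoisLog_eq_analyticLogv]
  exact ind1StripOf_infinite_of_jannsenWingberg v hJW p hv hp2 h3

/-- **Carrier form**: the (Ind1) strip slot `Real.ind1Strip (analyticLogv F) v` of the print signature `Real.logShellsPrint` is INFINITE at
every `v ∣ p` odd with `[K_v : ℚ_p] ≥ 3`, modulo Jannsen–Wingberg (the map `ψ ↦ ψ.toAddEquiv` is injective); Dupuy–Hilado's slot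
`Real.stripAutDH (inr v)` is `{1}`. [claim: Mochizuki2012, status: disputed] [cite: HoshiNishio2022OuterAutMLF, Cor 1.6 (i) p.5] -/
theorem ind1Strip_infinite_of_jannsenWingberg (hJW : JannsenWingbergTwists)
    (p : ℕ) [Fact p.Prime] (hv : ((p : ℕ) : 𝓞 F) ∈ v.asIdeal) (hp2 : p ≠ 2) (h3 : 3 ≤ localDeg F v) :
    (ind1Strip (analyticLogv F) v).Infinite := by
  intro hfin
  apply ind1StripOf_analyticLogv_infinite_of_jannsenWingberg v hJW p hv hp2 h3
  -- every element of the strip part is the additive part of a `ℚ`-linear automorphism in the carrier slot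
  have hsub : ind1StripOf v (analyticLogv F v) ⊆
      (fun ψ : Carrier (.inr v : Place F) ≃ₗ[ℚ] Carrier (.inr v : Place F) =>
        (ψ.toAddEquiv : v.adicCompletion F ≃+ v.adicCompletion F)) '' ind1Strip (analyticLogv F) v := by
    intro χ hχ
    let χ' : Carrier (.inr v : Place F) ≃+ Carrier (.inr v : Place F) := χ
    let Lχ : Carrier (.inr v : Place F) ≃ₗ[ℚ] Carrier (.inr v : Place F) :=
      χ'.toLinearEquiv fun c x => map_rat_smul χ' c x
    have hq : (Lχ.toAddEquiv : v.adicCompletion F ≃+ v.adicCompletion F) = χ := by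
      ext x; rfl
    refine ⟨Lχ, ?_, hq⟩
    change (Lχ.toAddEquiv : v.adicCompletion F ≃+ v.adicCompletion F) ∈ ind1StripOf v (analyticLogv F v)
    rw [hq]
    exact hχ
  exact (hfin.image _).subset hsub

end Summit.ABC.IUTFork.Thm311.Real

end
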